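import Literature.AlgebraicGeometry.Motives.HodgeLieWeightOneSl2CenterCorner
import HarnessLib

/-!
# Weight-one Hodge structures whose Hodge Lie algebra has a three-dimensional derived algebra and ARBITRARY centre.
# F: the two corners of `End_Hdg(V)` at the rational projector `p` — dimension `(rk p)²/4`, centre `ℚ p`, and the
# corner at `1 − p` as the commutant of the centre

Family `hodge`, layer `Literature/AlgebraicGeometry/Motives`; THEOREMS ONLY (no definition, no named fact; D-0026).
Sixth abstract file of the lane MT-RANK-SIX-ISOGENY of the cell `pub-hodgecm2` (COR-CM), seat `b27` (setting as in
`Motives/HodgeLieWeightOneSl2Center{,Commutator,Splitting,Vanishing,Corner}`: `p` the rational idempotent with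
`p_ℂ = π = α⁻¹(EF + FE)`).

* **`four_mul_finrank_corner_eq_sq`** — `4 · dim_ℚ {a ∈ End_Hdg(V) | a p = a} = (dim_ℚ range p)²`: the complex span of
  the rational corner is the corner of the commutant of `{P, E, F}` at `π` (Hodge endomorphisms commute with `P` and with
  `𝔥_ℂ ∋ E, F`; conversely `corner_descent`), of dimension `rk(Pπ)²` (`SL2Triple.finrank_corner_commutant_eq_sq`),
  and `rk π = 2 rk(Pπ) = rk p` (`two_mul_finrank_range_corner_eq`, `finrank_range_baseChange_eq`).
* **`exists_eq_smul_of_mem_center_corner`** — the centre of that corner is `ℚ p`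
  (`SL2Triple.exists_eq_smul_of_mem_center_corner_commutant` and rationality of the scalar).
* **`mem_endAlg_of_mul_projector_eq_zero`** — a rational endomorphism supported on `ker p` (`a p = 0 = p a`) commuting
  with the centre `𝔷 = 𝔥 ∩ End_Hdg(V)` is a Hodge endomorphism: on `ker π`, `2P − 1 = −α⁻¹ζ₀ ∈ 𝔷_ℂ`.

Classically: on `pV` the Hodge group acts through `SL₂` in isotypic position, so the Hodge endomorphisms of `pV` form a
central simple algebra of dimension `(rk p)²/4` over `ℚ` (split by `ℂ` into `M_{rk p/2}`); on `(1 − p)V` it acts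
through its central torus, so the Hodge endomorphisms there are the full commutant of the centre (Moonen–Zarhin 1999
§2; the case `dim 𝔷 = 1` is `Motives/HodgeLieWeightOneRankFour{Corner,Range}`).

## References

* [MoonenZarhin1999LowDim] B. Moonen, Yu. Zarhin, *Hodge classes on abelian varieties of low dimension*, Math. Ann. 315
  (1999), §2.
* [Deligne1982HodgeCycles] P. Deligne, *Hodge cycles on abelian varieties*, LNM 900 (1982), I §3 (3.1–3.7).
* [Zarhin1983HodgeGroupsK3] Yu. G. Zarhin, *Hodge groups of K3 surfaces*, J. reine angew. Math. 341 (1983), §2.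
* [FultonHarris1991] W. Fulton, J. Harris, *Representation Theory*, GTM 129 (1991), Lecture 11 (§11.1).
* [Humphreys1972] J. E. Humphreys, *Introduction to Lie Algebras and Representation Theory*, GTM 9 (1972), §6.1.
-/

noncomputable section

open scoped TensorProduct

namespace Literature.AlgebraicGeometry.Motives

universe u

namespace HodgeStructure

open ProjectorBlocks Literature.RepresentationTheory.GeneralLinear

variable {V : Type u} [AddCommGroup V] [Module ℚ V] [Module.Finite ℚ V] [HodgeTensorFacts.{u, u}] {n : ℤ}
  {S : Type u} [Fintype S] [DecidableEq S] {deg : S → ℤ}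

/-! ## §8 (continued) Dimension and centre of the corner at `p` -/

/-- **`4 · dim_ℚ {a ∈ End_Hdg(V) | a p = a} = (dim_ℚ range p)²`.**  The complex span of the rational corner is the corner
of the commutant of `{P, E, F}` at `π` (one inclusion: Hodge endomorphisms commute with `P` and with `𝔥_ℂ ∋ E, F`;
the other: `corner_descent`), of dimension `rk(Pπ)²` (`SL2Triple.finrank_corner_commutant_eq_sq`), and `rk π = 2 rk(Pπ)`,
`rk π = rk p`. [cite: FultonHarris1991, Lecture 11 (§11.1)] [cite: MoonenZarhin1999LowDim, §2]
[cite: Humphreys1972, §6.1] -/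
theorem four_mul_finrank_corner_eq_sq (H : HodgeStructure V n) (ψ : H.Polarization) (hn : n = 1)
    (e : Module.Basis S ℂ (ℂ ⊗[ℚ] V)) (hF : ∀ a, H.F a = Submodule.span ℂ (e '' {σ | a ≤ deg σ}))
    (hFc : ∀ a, complexConj (H.F a) = Submodule.span ℂ (e '' {σ | deg σ ≤ n - a}))
    (hdeg : ∀ σ, deg σ = 0 ∨ deg σ = 1) {X : Module.End ℚ V} (hX : X ∈ H.hodgeLie) (hXE : X ∉ H.endAlg)
    (h3 : Module.finrank ℚ ↥(Submodule.span ℚ {B | ∃ X ∈ H.hodgeLie, ∃ Y ∈ H.hodgeLie, X * Y - Y * X = B}) = 3)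
    {α : ℂ} (hα : α ≠ 0) {ζ₀ : Module.End ℂ (ℂ ⊗[ℚ] V)}
    (hζ₀ : ζ₀ ∈ spanC (H.hodgeLie ⊓ Subalgebra.toSubmodule H.endAlg))
    (hEF : (gradingEnd e deg * X.baseChange ℂ * (1 - gradingEnd e deg)) *
          ((1 - gradingEnd e deg) * X.baseChange ℂ * gradingEnd e deg) -
        ((1 - gradingEnd e deg) * X.baseChange ℂ * gradingEnd e deg) *
          (gradingEnd e deg * X.baseChange ℂ * (1 - gradingEnd e deg)) =
        α • ((2 : ℂ) • gradingEnd e deg - 1) + ζ₀)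
    {Q : Module.End ℂ (ℂ ⊗[ℚ] V)}
    (hQ : Q = α⁻¹ • ((gradingEnd e deg * X.baseChange ℂ * (1 - gradingEnd e deg)) *
          ((1 - gradingEnd e deg) * X.baseChange ℂ * gradingEnd e deg) +
        ((1 - gradingEnd e deg) * X.baseChange ℂ * gradingEnd e deg) *
          (gradingEnd e deg * X.baseChange ℂ * (1 - gradingEnd e deg))))
    {p : Module.End ℚ V} (hpQ : p.baseChange ℂ = Q) (hpp : p * p = p) (hpA : p ∈ H.endAlg)
    (hpc : ∀ a ∈ H.endAlg, a * p = p * a) :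
    4 * Module.finrank ℚ ↥(Subalgebra.toSubmodule H.endAlg ⊓ LinearMap.ker (LinearMap.mulRight ℚ p - LinearMap.id)) =
      Module.finrank ℚ (LinearMap.range p) ^ 2 := by
  classical
  subst hn
  set Cr := Subalgebra.toSubmodule H.endAlg ⊓ LinearMap.ker (LinearMap.mulRight ℚ p - LinearMap.id) with hCrdef
  have hCr : ∀ a, a ∈ Cr ↔ a ∈ H.endAlg ∧ a * p = a := by
    intro a
    simp only [hCrdef, Submodule.mem_inf, Subalgebra.mem_toSubmodule, LinearMap.mem_ker, LinearMap.sub_apply,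
      LinearMap.mulRight_apply, LinearMap.id_coe, id_eq, sub_eq_zero]
  obtain ⟨hEFE, hFEF, hQQ, hPQ, hEQ', hQE, hFQ', hQF', hEF', hFE', -, -, -⟩ :=
    projector_identities H rfl e hF hFc hdeg hX hα hζ₀ hEF hQ
  set P := gradingEnd e deg with hP
  set Y := X.baseChange ℂ with hY
  set E := P * Y * (1 - P) with hEdef
  set F := (1 - P) * Y * P with hFdef
  have hPP : P * P = P := gradingEnd_mul_gradingEnd_of_deg e hdeg
  have hPE : P * E = E := by rw [hEdef, ← mul_assoc, ← mul_assoc, hPP]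
  have hEP : E * P = 0 := by rw [hEdef, mul_assoc (P * Y) (1 - P) P, sub_mul, one_mul, hPP, sub_self, mul_zero]
  have hPF : P * F = 0 := by
    rw [hFdef, mul_assoc (1 - P) Y P, ← mul_assoc P (1 - P) (Y * P), mul_sub, mul_one, hPP, sub_self, zero_mul]
  have hFP : F * P = F := by rw [hFdef, mul_assoc ((1 - P) * Y) P P, hPP]
  have hYM : Y ∈ H.hodgeLieC := H.baseChange_mem_hodgeLieC hX
  obtain ⟨hEM, hFM⟩ := projE_mem_hodgeLieC H e hF hFc hdeg hYM
  rw [← hP, ← hEdef] at hEM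
  rw [← hP, ← hFdef] at hFM
  have hΘ' : (2 : ℂ) • P - 1 ∈ H.hodgeLieC := by
    simpa only [Int.cast_one, one_smul] using two_smul_gradingEnd_sub_mem_hodgeLieC H e hF hFc
  -- the complex corner
  set C : Submodule ℂ (Module.End ℂ (ℂ ⊗[ℚ] V)) :=
    LinearMap.ker (LinearMap.mulRight ℂ P - LinearMap.mulLeft ℂ P) ⊓
      LinearMap.ker (LinearMap.mulRight ℂ E - LinearMap.mulLeft ℂ E) ⊓
      LinearMap.ker (LinearMap.mulRight ℂ F - LinearMap.mulLeft ℂ F) with hCdef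
  have hC : ∀ T, T ∈ C ↔ T * P = P * T ∧ T * E = E * T ∧ T * F = F * T := by
    intro T
    simp only [hCdef, Submodule.mem_inf, LinearMap.mem_ker, LinearMap.sub_apply, LinearMap.mulRight_apply,
      LinearMap.mulLeft_apply, sub_eq_zero, and_assoc]
  set Dc : Submodule ℂ (Module.End ℂ (ℂ ⊗[ℚ] V)) :=
    C ⊓ LinearMap.ker (LinearMap.mulRight ℂ Q - LinearMap.id) ⊓ LinearMap.ker (LinearMap.mulLeft ℂ Q - LinearMap.id)
    with hDcdef
  have hDc : ∀ T, T ∈ Dc ↔ T ∈ C ∧ T * Q = T ∧ Q * T = T := by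
    intro T
    simp only [hDcdef, Submodule.mem_inf, LinearMap.mem_ker, LinearMap.sub_apply, LinearMap.mulRight_apply,
      LinearMap.mulLeft_apply, LinearMap.id_coe, id_eq, sub_eq_zero, and_assoc]
  -- `spanC Cr = Dc`
  have hspan : spanC Cr = Dc := by
    apply le_antisymm
    · unfold spanC
      rw [Submodule.span_le]
      rintro _ ⟨a, ha, rfl⟩
      obtain ⟨haA, hap⟩ := (hCr a).1 ha
      have hpa : p * a = a := by rw [← hpc a haA, hap]
      rw [SetLike.mem_coe, hDc, hC]
      have haΘ := commute_baseChange_of_mem_hodgeLieC H hΘ' ⟨a, haA⟩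
      have haP : a.baseChange ℂ * P = P * a.baseChange ℂ := by
        rw [mul_sub _ _ (1 : Module.End ℂ (ℂ ⊗[ℚ] V)), sub_mul _ (1 : Module.End ℂ (ℂ ⊗[ℚ] V)), mul_one, one_mul,
          mul_smul_comm, smul_mul_assoc, sub_left_inj] at haΘ
        exact (smul_right_injective _ (two_ne_zero' ℂ) haΘ).symm
      refine ⟨⟨haP, (commute_baseChange_of_mem_hodgeLieC H hEM ⟨a, haA⟩).symm,
        (commute_baseChange_of_mem_hodgeLieC H hFM ⟨a, haA⟩).symm⟩, ?_, ?_⟩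
      · rw [← hpQ, ← LinearMap.baseChange_mul, hap]
      · rw [← hpQ, ← LinearMap.baseChange_mul, hpa]
    · intro T hT
      obtain ⟨hTC, hTQ, -⟩ := (hDc T).1 hT
      obtain ⟨-, hTE, hTF⟩ := (hC T).1 hTC
      exact corner_descent H ψ rfl e hF hFc hdeg hX hXE h3 hα hζ₀ hEF hQ hpQ hpp hTE hTF hTQ
  -- dimensions
  have h1 : Module.finrank ℚ Cr = Module.finrank ℂ Dc := by
    rw [← hspan]
    unfold spanC
    rw [finrank_span_baseChange_image]
  have h2 : Module.finrank ℂ Dc = Module.finrank ℂ (LinearMap.range (P * Q)) ^ 2 :=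
    SL2Triple.finrank_corner_commutant_eq_sq hα hQQ hPQ hPP hPE hEP hPF hFP hEQ' hQE hFQ' hQF' hEF' hFE' hC hDc
  have h3' := two_mul_finrank_range_corner_eq hα hPP hQQ hPQ hEFE hFEF hEF' hFE'
  have h4 : Module.finrank ℂ (LinearMap.range Q) = Module.finrank ℚ (LinearMap.range p) := by
    rw [← hpQ, finrank_range_baseChange_eq]
  rw [h1, h2, ← h4, ← h3']
  ring

/-- **The centre of the corner `{a ∈ End_Hdg(V) | a p = a}` is `ℚ p`**: a Hodge endomorphism `z` with `z p = z`
commuting with every Hodge endomorphism `a` with `a p = a` is a rational multiple of `p` (its complexification is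
central in the complex corner by `corner_descent`, hence `c π` by `SL2Triple.exists_eq_smul_of_mem_center_corner_commutant`,
with `c ∈ ℚ`). [cite: Humphreys1972, §6.1] [cite: MoonenZarhin1999LowDim, §2] -/
theorem exists_eq_smul_of_mem_center_corner (H : HodgeStructure V n) (ψ : H.Polarization) (hn : n = 1)
    (e : Module.Basis S ℂ (ℂ ⊗[ℚ] V)) (hF : ∀ a, H.F a = Submodule.span ℂ (e '' {σ | a ≤ deg σ}))
    (hFc : ∀ a, complexConj (H.F a) = Submodule.span ℂ (e '' {σ | deg σ ≤ n - a}))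
    (hdeg : ∀ σ, deg σ = 0 ∨ deg σ = 1) {X : Module.End ℚ V} (hX : X ∈ H.hodgeLie) (hXE : X ∉ H.endAlg)
    (h3 : Module.finrank ℚ ↥(Submodule.span ℚ {B | ∃ X ∈ H.hodgeLie, ∃ Y ∈ H.hodgeLie, X * Y - Y * X = B}) = 3)
    {α : ℂ} (hα : α ≠ 0) {ζ₀ : Module.End ℂ (ℂ ⊗[ℚ] V)}
    (hζ₀ : ζ₀ ∈ spanC (H.hodgeLie ⊓ Subalgebra.toSubmodule H.endAlg))
    (hEF : (gradingEnd e deg * X.baseChange ℂ * (1 - gradingEnd e deg)) *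
          ((1 - gradingEnd e deg) * X.baseChange ℂ * gradingEnd e deg) -
        ((1 - gradingEnd e deg) * X.baseChange ℂ * gradingEnd e deg) *
          (gradingEnd e deg * X.baseChange ℂ * (1 - gradingEnd e deg)) =
        α • ((2 : ℂ) • gradingEnd e deg - 1) + ζ₀)
    {Q : Module.End ℂ (ℂ ⊗[ℚ] V)}
    (hQ : Q = α⁻¹ • ((gradingEnd e deg * X.baseChange ℂ * (1 - gradingEnd e deg)) *
          ((1 - gradingEnd e deg) * X.baseChange ℂ * gradingEnd e deg) +
        ((1 - gradingEnd e deg) * X.baseChange ℂ * gradingEnd e deg) *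
          (gradingEnd e deg * X.baseChange ℂ * (1 - gradingEnd e deg))))
    {p : Module.End ℚ V} (hpQ : p.baseChange ℂ = Q) (hpp : p * p = p) (hp0 : p ≠ 0)
    (hpc : ∀ a ∈ H.endAlg, a * p = p * a)
    {z : Module.End ℚ V} (hzA : z ∈ H.endAlg) (hzp : z * p = z)
    (hzc : ∀ a ∈ H.endAlg, a * p = a → z * a = a * z) : ∃ c : ℚ, z = c • p := by
  classical
  subst hn
  set Cr := Subalgebra.toSubmodule H.endAlg ⊓ LinearMap.ker (LinearMap.mulRight ℚ p - LinearMap.id) with hCrdef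
  have hCr : ∀ a, a ∈ Cr ↔ a ∈ H.endAlg ∧ a * p = a := by
    intro a
    simp only [hCrdef, Submodule.mem_inf, Subalgebra.mem_toSubmodule, LinearMap.mem_ker, LinearMap.sub_apply,
      LinearMap.mulRight_apply, LinearMap.id_coe, id_eq, sub_eq_zero]
  obtain ⟨hEFE, -, hQQ, hPQ, hEQ', hQE, hFQ', hQF', hEF', hFE', -, -, -⟩ :=
    projector_identities H rfl e hF hFc hdeg hX hα hζ₀ hEF hQ
  obtain ⟨hE0, -⟩ := projE_ne_zero_of_not_mem_endAlg H rfl e hF hFc hdeg hXE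
  set P := gradingEnd e deg with hP
  set Y := X.baseChange ℂ with hY
  set E := P * Y * (1 - P) with hEdef
  set F := (1 - P) * Y * P with hFdef
  have hPP : P * P = P := gradingEnd_mul_gradingEnd_of_deg e hdeg
  have hPE : P * E = E := by rw [hEdef, ← mul_assoc, ← mul_assoc, hPP]
  have hEP : E * P = 0 := by rw [hEdef, mul_assoc (P * Y) (1 - P) P, sub_mul, one_mul, hPP, sub_self, mul_zero]
  have hPF : P * F = 0 := by
    rw [hFdef, mul_assoc (1 - P) Y P, ← mul_assoc P (1 - P) (Y * P), mul_sub, mul_one, hPP, sub_self, zero_mul]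
  have hFP : F * P = F := by rw [hFdef, mul_assoc ((1 - P) * Y) P P, hPP]
  have hYM : Y ∈ H.hodgeLieC := H.baseChange_mem_hodgeLieC hX
  obtain ⟨hEM, hFM⟩ := projE_mem_hodgeLieC H e hF hFc hdeg hYM
  rw [← hP, ← hEdef] at hEM
  rw [← hP, ← hFdef] at hFM
  have hΘ' : (2 : ℂ) • P - 1 ∈ H.hodgeLieC := by
    simpa only [Int.cast_one, one_smul] using two_smul_gradingEnd_sub_mem_hodgeLieC H e hF hFc
  set C : Submodule ℂ (Module.End ℂ (ℂ ⊗[ℚ] V)) :=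
    LinearMap.ker (LinearMap.mulRight ℂ P - LinearMap.mulLeft ℂ P) ⊓
      LinearMap.ker (LinearMap.mulRight ℂ E - LinearMap.mulLeft ℂ E) ⊓
      LinearMap.ker (LinearMap.mulRight ℂ F - LinearMap.mulLeft ℂ F) with hCdef
  have hC : ∀ T, T ∈ C ↔ T * P = P * T ∧ T * E = E * T ∧ T * F = F * T := by
    intro T
    simp only [hCdef, Submodule.mem_inf, LinearMap.mem_ker, LinearMap.sub_apply, LinearMap.mulRight_apply,
      LinearMap.mulLeft_apply, sub_eq_zero, and_assoc]
  set Dc : Submodule ℂ (Module.End ℂ (ℂ ⊗[ℚ] V)) :=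
    C ⊓ LinearMap.ker (LinearMap.mulRight ℂ Q - LinearMap.id) ⊓ LinearMap.ker (LinearMap.mulLeft ℂ Q - LinearMap.id)
    with hDcdef
  have hDc : ∀ T, T ∈ Dc ↔ T ∈ C ∧ T * Q = T ∧ Q * T = T := by
    intro T
    simp only [hDcdef, Submodule.mem_inf, LinearMap.mem_ker, LinearMap.sub_apply, LinearMap.mulRight_apply,
      LinearMap.mulLeft_apply, LinearMap.id_coe, id_eq, sub_eq_zero, and_assoc]
  -- a Hodge endomorphism `a` with `a p = a` has `a_ℂ ∈ Dc`
  have hmemDc : ∀ a ∈ H.endAlg, a * p = a → a.baseChange ℂ ∈ Dc := by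
    intro a haA hap
    have hpa : p * a = a := by rw [← hpc a haA, hap]
    rw [hDc, hC]
    have haΘ := commute_baseChange_of_mem_hodgeLieC H hΘ' ⟨a, haA⟩
    have haP : a.baseChange ℂ * P = P * a.baseChange ℂ := by
      rw [mul_sub _ _ (1 : Module.End ℂ (ℂ ⊗[ℚ] V)), sub_mul _ (1 : Module.End ℂ (ℂ ⊗[ℚ] V)), mul_one, one_mul,
        mul_smul_comm, smul_mul_assoc, sub_left_inj] at haΘ
      exact (smul_right_injective _ (two_ne_zero' ℂ) haΘ).symm
    refine ⟨⟨haP, (commute_baseChange_of_mem_hodgeLieC H hEM ⟨a, haA⟩).symm,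
      (commute_baseChange_of_mem_hodgeLieC H hFM ⟨a, haA⟩).symm⟩, ?_, ?_⟩
    · rw [← hpQ, ← LinearMap.baseChange_mul, hap]
    · rw [← hpQ, ← LinearMap.baseChange_mul, hpa]
  have hzDc : z.baseChange ℂ ∈ Dc := hmemDc z hzA hzp
  -- `z_ℂ` is central in `Dc`
  have hcomm_span : ∀ T'' ∈ spanC Cr, z.baseChange ℂ * T'' = T'' * z.baseChange ℂ := by
    intro T'' hmem
    unfold spanC at hmem
    induction hmem using Submodule.span_induction with
    | mem T'' hT'' =>
      obtain ⟨a, ha, rfl⟩ := hT''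
      obtain ⟨haA, hap⟩ := (hCr a).1 ha
      rw [← LinearMap.baseChange_mul, ← LinearMap.baseChange_mul, hzc a haA hap]
    | zero => rw [mul_zero, zero_mul]
    | add x y _ _ hx hy => rw [mul_add, add_mul, hx, hy]
    | smul c x _ hx => rw [mul_smul_comm, smul_mul_assoc, hx]
  have hcen : ∀ T' ∈ Dc, z.baseChange ℂ * T' = T' * z.baseChange ℂ := by
    intro T' hT'
    obtain ⟨hT'C, hT'Q, -⟩ := (hDc T').1 hT'
    obtain ⟨-, hT'E, hT'F⟩ := (hC T').1 hT'C
    exact hcomm_span T' (corner_descent H ψ rfl e hF hFc hdeg hX hXE h3 hα hζ₀ hEF hQ hpQ hpp hT'E hT'F hT'Q)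
  have hPQ0 : P * Q ≠ 0 := by
    intro h0
    apply hE0
    have h1 : E * F = 0 := by rw [hEF', h0, smul_zero]
    have h2 : α • E = 0 := by rw [← hEFE, h1, zero_mul]
    exact (smul_eq_zero.1 h2).resolve_left hα
  obtain ⟨c, hc⟩ := SL2Triple.exists_eq_smul_of_mem_center_corner_commutant hα hQQ hPQ hPP hPE hEP hPF hFP hEQ' hQE
    hFQ' hQF' hEF' hFE' hPQ0 hC hDc hzDc hcen
  rw [← hpQ] at hc
  obtain ⟨q, hq⟩ := exists_ratCast_eq_of_baseChange_eq_smul hp0 hc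
  refine ⟨q, ?_⟩
  apply sub_eq_zero.1
  apply eq_zero_of_baseChange_eq_zero
  rw [LinearMap.baseChange_sub, hc, baseChange_ratCast_smul, hq, sub_self]

/-! ## §9 The corner at `1 − p`: Hodge endomorphisms are the commutant of the centre -/

/-- **A rational endomorphism supported on `ker p` (`a p = 0 = p a`) commuting with the centre `𝔷 = 𝔥 ∩ End_Hdg(V)` is
a Hodge endomorphism**: on `ker π` the Hodge operator `2P − 1` equals `−α⁻¹ζ₀ ∈ 𝔷_ℂ` (`π = 1 + α⁻¹ζ₀(2P−1)`), so
`a_ℂ` commutes with `2P − 1`. [cite: MoonenZarhin1999LowDim, §2] [cite: Deligne1982HodgeCycles, I §3 (3.1–3.7)] -/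
theorem mem_endAlg_of_mul_projector_eq_zero (H : HodgeStructure V n) (hn : n = 1)
    (e : Module.Basis S ℂ (ℂ ⊗[ℚ] V)) (hF : ∀ a, H.F a = Submodule.span ℂ (e '' {σ | a ≤ deg σ}))
    (hFc : ∀ a, complexConj (H.F a) = Submodule.span ℂ (e '' {σ | deg σ ≤ n - a}))
    (hdeg : ∀ σ, deg σ = 0 ∨ deg σ = 1) {X : Module.End ℚ V} (hX : X ∈ H.hodgeLie)
    {α : ℂ} (hα : α ≠ 0) {ζ₀ : Module.End ℂ (ℂ ⊗[ℚ] V)}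
    (hζ₀ : ζ₀ ∈ spanC (H.hodgeLie ⊓ Subalgebra.toSubmodule H.endAlg))
    (hEF : (gradingEnd e deg * X.baseChange ℂ * (1 - gradingEnd e deg)) *
          ((1 - gradingEnd e deg) * X.baseChange ℂ * gradingEnd e deg) -
        ((1 - gradingEnd e deg) * X.baseChange ℂ * gradingEnd e deg) *
          (gradingEnd e deg * X.baseChange ℂ * (1 - gradingEnd e deg)) =
        α • ((2 : ℂ) • gradingEnd e deg - 1) + ζ₀)
    {Q : Module.End ℂ (ℂ ⊗[ℚ] V)}
    (hQ : Q = α⁻¹ • ((gradingEnd e deg * X.baseChange ℂ * (1 - gradingEnd e deg)) *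
          ((1 - gradingEnd e deg) * X.baseChange ℂ * gradingEnd e deg) +
        ((1 - gradingEnd e deg) * X.baseChange ℂ * gradingEnd e deg) *
          (gradingEnd e deg * X.baseChange ℂ * (1 - gradingEnd e deg))))
    {p : Module.End ℚ V} (hpQ : p.baseChange ℂ = Q) {a : Module.End ℚ V} (hap : a * p = 0) (hpa : p * a = 0)
    (haZ : ∀ Z ∈ H.hodgeLie ⊓ Subalgebra.toSubmodule H.endAlg, a * Z = Z * a) : a ∈ H.endAlg := by
  classical
  subst hn
  obtain ⟨-, -, -, -, -, -, -, -, -, -, hQ1, -, -⟩ := projector_identities H rfl e hF hFc hdeg hX hα hζ₀ hEF hQ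
  set P := gradingEnd e deg with hP
  have hPP : P * P = P := gradingEnd_mul_gradingEnd_of_deg e hdeg
  have hζP : ζ₀ * P = P * ζ₀ := commute_gradingEnd_of_mem_spanC_center H rfl e hF hFc hζ₀
  have hζΘ : ζ₀ * ((2 : ℂ) • P - 1) = ((2 : ℂ) • P - 1) * ζ₀ := by
    rw [mul_sub, sub_mul, mul_smul_comm, smul_mul_assoc, hζP, mul_one, one_mul]
  set β := a.baseChange ℂ with hβ
  -- `β` commutes with `ζ₀ ∈ 𝔷_ℂ`
  have hβζ : β * ζ₀ = ζ₀ * β := by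
    have h : ∀ ζ ∈ spanC (H.hodgeLie ⊓ Subalgebra.toSubmodule H.endAlg), β * ζ = ζ * β := by
      intro ζ hζ
      unfold spanC at hζ
      induction hζ using Submodule.span_induction with
      | mem Z hZ =>
        obtain ⟨Z₀, hZ₀, rfl⟩ := hZ
        rw [hβ, ← LinearMap.baseChange_mul, haZ Z₀ hZ₀, LinearMap.baseChange_mul]
      | zero => rw [mul_zero, zero_mul]
      | add x y _ _ hx hy => rw [mul_add, add_mul, hx, hy]
      | smul c x _ hx => rw [mul_smul_comm, smul_mul_assoc, hx]
    exact h ζ₀ hζ₀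
  have hβQ : β * Q = 0 := by rw [hβ, ← hpQ, ← LinearMap.baseChange_mul, hap, LinearMap.baseChange_zero]
  have hQβ : Q * β = 0 := by rw [hβ, ← hpQ, ← LinearMap.baseChange_mul, hpa, LinearMap.baseChange_zero]
  -- `(1 − Q)(2P − 1) = −α⁻¹ ζ₀ = (2P − 1)(1 − Q)`
  have hΘΘ : ((2 : ℂ) • P - 1) * ((2 : ℂ) • P - 1) = 1 := theta_mul_theta hPP
  have h1Q : (1 - Q) * ((2 : ℂ) • P - 1) = (-α⁻¹) • ζ₀ := by
    rw [sub_mul 1 Q _, one_mul, hQ1, add_mul 1 _ _, one_mul, smul_mul_assoc, mul_assoc ζ₀ _ _, hΘΘ, mul_one]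
    module
  have hQ1' : ((2 : ℂ) • P - 1) * (1 - Q) = (-α⁻¹) • ζ₀ := by
    rw [mul_sub _ 1 Q, mul_one, hQ1, mul_add _ 1 _, mul_one, mul_smul_comm, ← mul_assoc _ ζ₀ _, ← hζΘ,
      mul_assoc ζ₀ _ _, hΘΘ, mul_one]
    module
  have hβΘ : β * ((2 : ℂ) • P - 1) = ((2 : ℂ) • P - 1) * β := by
    calc β * ((2 : ℂ) • P - 1) = β * (1 - Q) * ((2 : ℂ) • P - 1) := by rw [mul_sub β 1 Q, mul_one, hβQ, sub_zero]
      _ = (-α⁻¹) • (β * ζ₀) := by rw [mul_assoc, h1Q, mul_smul_comm]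
      _ = (-α⁻¹) • (ζ₀ * β) := by rw [hβζ]
      _ = ((2 : ℂ) • P - 1) * (1 - Q) * β := by rw [hQ1', smul_mul_assoc]
      _ = ((2 : ℂ) • P - 1) * β := by rw [mul_assoc, sub_mul 1 Q β, one_mul, hQβ, sub_zero]
  have hβP : β * P = P * β := by
    rw [mul_sub β _ 1, sub_mul _ 1 β, mul_one, one_mul, mul_smul_comm, smul_mul_assoc, sub_left_inj] at hβΘ
    exact smul_right_injective _ (two_ne_zero' ℂ) hβΘ
  exact mem_endAlg_of_projE_eq_zero H e hF hdeg (blocks_D hPP hβP).1 (blocks_D hPP hβP).2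

end HodgeStructure

end Literature.AlgebraicGeometry.Motives

end
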